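import Summits.ResolutionOfSingularities.ResolutionOfSingularities.Theorems.FrobeniusLadderFInjectiveMacaulayficationIntrinsicTower
import Literature.RingTheory.TightClosure.FrobeniusPushforward
import HarnessLib

/-!
# «TT» v2 — THE INTRINSIC-CENTRE TOWER, RECIPE-PARAMETRIC — SORRY-FREE (TT-K v2)
# (crux `FInjectiveMacaulayfication` stmt-ResolutionOfSingularities-15315, chain w45a; res-L1-w45a-plan-1 g19 RULINGS R19.4 (2)(3c) / R19.5 (3): the planner desk
# file v2 `L/w45a/TauTowerSig.lean` sha16 1c471f18f0788d50 VERBATIM modulo the two ruled renames — namespace `…IntrinsicTower.Recipes`, `TowerFull ↦ RecipeTowerFull`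
# (+ `towerFull_zero/succ ↦ recipeTowerFull_zero/succ`), and `nonFullLocus` IMPORTED from `…IntrinsicTower` (p631540) instead of re-declared —, with BOTH
# commissioned `sorry`s PROVED; Lemma A-REG by the induction of res-L1-w45a-lead-1 g9's `FullCentreDescent` (p631132: floor zero, transports, ONE descent step) with
# the invariant «REGULAR off a proper closed F» (R19.5 (3): proved inside this file, lead-1's generic regular twin not being in the tree at filing time); seat res-L1-w45a-stub-2 g8)

[OURS · L1 W4.5a] Support file (`--supports stmt-ResolutionOfSingularities-15315 --as helper`); NOT a statement of any manuscript; the definitions and the two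
`@[conjecture]`s are the desk's; the theorems are unconditional except the door terms (conditional BY NAME). AI-written (AI review is weaker than expert review).

Door v41 `Lines/step_door.lean`; the open F-half stub `LocalFullificationFibreAdmGe4Split.LocalFInjectivizationFibreAdmGe4` is an ∃-statement (∃ a fibre-supported
centre whose blow-ups are FULL everywhere) that no computation can refute. This file types «follow ONE intrinsic centre recipe `c` floor by floor until FULL» for
an ARBITRARY recipe `c`, proves nothing about any recipe, and proves the two kernel targets that make ANY Sing-supported recipe's termination imply the F-half:

* `CentreRecipe` := `∀ (p : ℕ) (S : Scheme.{0}), S.IdealSheafData`; `SingSupported c` := the support of `c p S` lies in the closure of the singular locus;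
* `RecipeTowerFull c p n S` := EVERY chain of `n` blow-ups, each along the recipe's centre of the floor below, starting at `S`, ends FULL at every point
  (structural recursion on `n`; blow-ups are unique up to unique isomorphism, so «every» = «the»);
* `TowerTerminates c` := the F-half's binders VERBATIM, conclusion `∃ n, RecipeTowerFull c p n S′`;
* ★ Lemma A `exists_fibreCentre_of_towerFull` — PROVED: `c` Sing-supported, `S` Noetherian integral, REGULAR off a PROPER closed `F`, `RecipeTowerFull c p n S`
  ⇒ ∃ 𝓚 ≠ ⊥ supported in `F` with EVERY blow-up along 𝓚 FULL everywhere — the induction of `FullCentreDescent.exists_fullCentre_of_tower` (p631132) re-run with the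
  REGULAR invariant (its §1 floor zero, §2 transports and §3 descent step BY NAME; induction
  on `n`, invariant «regular off a proper closed F»: the centre's support ⊆ closure Sing ⊆ F, so the centre is ≠ ⊥ — DEGENERACY NOTE: a dense centre-locus
  would give centre `⊥`, an EMPTY blow-up and a VACUOUS tower; the blow-up is an iso off its centre, so the next floor is regular off the preimage of `F`, again
  proper; compose by `IsBlowup.exists_isBlowup_comp_supported`, transport FULL along `IsBlowup.unique` + `FTemkinClosedPoints.fullCl_of_isIso_stalkMap'`; `n = 0`: 𝓚 = ⊤);
* ★★ `localFInjectivizationFibreAdmGe4_of_towerTerminates` — PROVED: `SingSupported c → TowerTerminates c → F-half` (Lemma A with `F` := the closed fibre of `g`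
  — closed as the preimage of the closed point; PROPER because the generic point of `Spec 𝒪_{X,x}` is regular (`genericPoint_mem_regularLocus`), hence off
  `supp I ⊆ (Reg)ᶜ`, so `g` has a point over it, and it is not the closed point since `x ∉ Reg X` (flatness of `X.fromSpecStalk x`); REGULAR off the fibre is the
  F-half's own binder — one step shorter than the v1 bridge `IntrinsicTower.localFInjectivizationFibreAdmGe4_of_intrinsicTowerConjecture`);
* TWO CONCRETE RECIPES (instance-free renderings of res-L1-w45a-idea-1's Sketch-L1-idea-1-r21 §2/§2b, here intersected with the singular locus so that
  `SingSupported` is definitionally cheap): `tauCentre` = the reduced closure of the (non-F-REGULAR ∪ non-FULL) singular locus — **THE RECIPE OF RECORD**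
  (FB5-r4/FB5-r5 evidence: every rad-τ tower of the bed terminates, 16/16 ≤ 6 floors; every τ-seeded tower terminates) —, and `nonFullCentre` = the reduced
  closure of the non-FULL locus — **A VARIANT UNDER REFUTATION** (FB5-r5 §3.2, kit j307492: from the point floor it STALLS on P2d4B, d3y3u5, d3lx6c,
  d4y3u5t5 — not FULL by floor 9, plateaux with constant generic local ring); the instance-free `tightClosure'` / `testIdeal'` / `nonFRegLocus` are VERBATIM
  idea-1's Sketch r21 §2b (credited; names only: Hochster–Huneke 1990);
* `@[conjecture] TauTowerConjecture := TowerTerminates tauCentre` (of record) and `@[conjecture] NonFullTowerConjecture := TowerTerminates nonFullCentre`;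
* door terms: the v41 deciding term with the F-half := (any Sing-supported terminating recipe), and its `tauCentre` instance (candidate line v42
  «INTRINSIC-CENTRE», by evidence only: kernel-STRONGER residue than v41's, so it does not replace v41 — R18.7; registration guard R19.5 (2)).
Everything OURS, counted 0; NOTHING of the crux is proved here; the crux follows BY NAME from {four prints, `TauTowerConjecture`, T″(p,e,1)}, and
`TauTowerConjecture` is refutable by one computation. [folklore assembly; cite: Temkin2008, Lemma 2.1.4; StacksProject, Tag 080B; Tag 02OS; HochsterHuneke1990, §8]
-/

set_option linter.dupNamespace false

noncomputable section

open AlgebraicGeometry CategoryTheory CategoryTheory.Limits Literature.AlgebraicGeometry.Resolution TopologicalSpace IsLocalRing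

namespace Summit.ResolutionOfSingularities.ResolutionOfSingularities.Theorems.FInjectiveMacaulayfication.IntrinsicTower.Recipes

open Summit.ResolutionOfSingularities.ResolutionOfSingularities.Theorems.FInjectiveMacaulayfication
open SliceableCentre IntrinsicTower

/-! ## §1 Recipes -/

/-- A CENTRE RECIPE: an ideal sheaf on every scheme (for every prime `p`). [OURS] -/
abbrev CentreRecipe := ∀ (_p : ℕ) (S : Scheme.{0}), S.IdealSheafData

/-- A recipe is Sing-SUPPORTED if its centre on `S` is supported in the closure of the singular locus of `S`. [OURS] -/
def SingSupported (c : CentreRecipe) : Prop :=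
  ∀ (p : ℕ) (S : Scheme.{0}), ((c p S).support : Set S) ⊆ closure ((Scheme.regularLocus S)ᶜ)

/-- Instance-free TIGHT CLOSURE (the ideal generated by the Hochster–Huneke set; equals `Literature.RingTheory.TightClosure.tightClosure p I` under
`[ExpChar A p]`). [OURS rendering — verbatim res-L1-w45a-idea-1 Sketch-L1-idea-1-r21 §2b] -/
def tightClosure' (p : ℕ) {A : Type} [CommRing A] (I : Ideal A) : Ideal A :=
  Ideal.span {x : A | ∃ c ∈ Literature.RingTheory.TightClosure.minimalPrimesCompl A, ∃ e₀ : ℕ, ∀ e ≥ e₀,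
    c * x ^ p ^ e ∈ Literature.RingTheory.TightClosure.frobeniusPower (p ^ e) I}

/-- The (finitistic) TEST IDEAL `τ(A) = ⋂_I (I : I^*)`. [names only: Hochster–Huneke 1990; OURS rendering — verbatim idea-1 Sketch r21 §2b] -/
def testIdeal' (p : ℕ) (A : Type) [CommRing A] : Ideal A :=
  ⨅ I : Ideal A, Submodule.colon I (tightClosure' p I)

/-- The NON-F-REGULAR LOCUS of `S`: points whose stalk has test ideal `≠ (1)`. [OURS — idea-1 Sketch r21 §2b] -/
def nonFRegLocus (p : ℕ) (S : Scheme.{0}) : Set S := {s | testIdeal' p (S.presheaf.stalk s) ≠ ⊤}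

/-- **THE RECIPE OF RECORD «rad τ ∩ Sing»**: the reduced (vanishing) ideal sheaf of the closure of the non-F-regular-or-non-FULL SINGULAR locus
(engine mode `radtau` of FB5-r4/FB5-r5; on the bed the intersection with Sing changes nothing, regular points being F-regular). [OURS] -/
def tauCentre : CentreRecipe := fun p S =>
  Scheme.IdealSheafData.vanishingIdeal ⟨closure ((nonFRegLocus p S ∪ nonFullLocus p S) ∩ (Scheme.regularLocus S)ᶜ), isClosed_closure⟩

/-- **THE VARIANT «N_red»** (under refutation, FB5-r5 §3.2): the reduced ideal sheaf of the closure of the non-FULL locus (a non-FULL point is singular,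
so no intersection is needed for Sing-support; it is kept for uniformity). [OURS] -/
def nonFullCentre : CentreRecipe := fun p S =>
  Scheme.IdealSheafData.vanishingIdeal ⟨closure (nonFullLocus p S ∩ (Scheme.regularLocus S)ᶜ), isClosed_closure⟩

/-- The recipe of record is Sing-supported (by construction). [OURS] -/
theorem singSupported_tauCentre : SingSupported tauCentre := by
  intro p S
  simp only [tauCentre, Scheme.IdealSheafData.coe_support_vanishingIdeal]
  exact closure_mono Set.inter_subset_right

/-- The variant is Sing-supported (by construction). [OURS] -/
theorem singSupported_nonFullCentre : SingSupported nonFullCentre := by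
  intro p S
  simp only [nonFullCentre, Scheme.IdealSheafData.coe_support_vanishingIdeal]
  exact closure_mono Set.inter_subset_right

/-! ## §2 Towers and the killable conjectures -/

/-- `RecipeTowerFull c p n S`: EVERY chain of `n` blowing ups, each along the recipe's centre of the floor below, starting at `S`, ends at a scheme that is
FULL at every point. [OURS] (the desk's `TowerFull c`; renamed per R19.4 (3c) to keep `IntrinsicTower.TowerFull` for the v1 recipe) -/
def RecipeTowerFull (c : CentreRecipe) (p : ℕ) : ℕ → Scheme.{0} → Prop
  | 0 => fun S => ∀ s : S, FullCl p (S.presheaf.stalk s)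
  | n + 1 => fun S => ∀ (S₁ : Scheme.{0}) (g : S₁ ⟶ S), IsBlowup g (c p S) → RecipeTowerFull c p n S₁

/-- Floor zero of a recipe tower, unfolded. [OURS] -/
theorem recipeTowerFull_zero {c : CentreRecipe} {p : ℕ} {S : Scheme.{0}} : RecipeTowerFull c p 0 S ↔ ∀ s : S, FullCl p (S.presheaf.stalk s) :=
  Iff.rfl

/-- The successor clause of a recipe tower, unfolded. [OURS] -/
theorem recipeTowerFull_succ {c : CentreRecipe} {p n : ℕ} {S : Scheme.{0}} :
    RecipeTowerFull c p (n + 1) S ↔ ∀ (S₁ : Scheme.{0}) (g : S₁ ⟶ S), IsBlowup g (c p S) → RecipeTowerFull c p n S₁ := Iff.rfl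

/-- [OURS · CANDIDATE statement shape, KILLABLE per recipe] **(TT[c]) THE `c`-TOWER TERMINATES.** Binders VERBATIM those of the F-half
`LocalFullificationFibreAdmGe4Split.LocalFInjectivizationFibreAdmGe4`; conclusion: for some `n`, the tower of `n` blow-ups along the successive `c`-centres of
`S′` ends FULL everywhere. ONE admissible floor whose `c`-tower loops or never purifies refutes it. -/
def TowerTerminates (c : CentreRecipe) : Prop :=
  ∀ d : ℕ, 4 ≤ d →
  ∀ (p : ℕ), p.Prime → ∀ (k : Type) [Field k] [CharP k p]
    (X : Scheme.{0}) (f : X ⟶ Spec (.of k)),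
      IsSeparated f → LocallyOfFiniteType f → QuasiCompact f → IsIntegral X →
  ∀ x : X, IsClosed ({x} : Set X) → x ∉ Scheme.regularLocus X → ringKrullDim (X.presheaf.stalk x) = d →
  ∀ (S' : Scheme.{0}) (g : S' ⟶ Spec (X.presheaf.stalk x)) (I : (Spec (X.presheaf.stalk x)).IdealSheafData),
    I ≠ ⊥ → (I.support : Set (Spec (X.presheaf.stalk x))) ⊆ (Scheme.regularLocus (Spec (X.presheaf.stalk x)))ᶜ → IsBlowup g I →
    (∀ s : S', g.base s ≠ closedPoint (X.presheaf.stalk x) → s ∈ Scheme.regularLocus S') →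
    (∀ s : S', CMCl (S'.presheaf.stalk s)) →
    ∃ n : ℕ, RecipeTowerFull c p n S'

/-- [OURS · CANDIDATE statement, KILLABLE — **THE CONJECTURE OF RECORD**] the rad-τ-∩-Sing tower terminates from every admissible CM floor. -/
@[conjecture] def TauTowerConjecture : Prop := TowerTerminates tauCentre

/-- [OURS · CANDIDATE statement, KILLABLE — **VARIANT UNDER REFUTATION** (FB5-r5 §3.2, kit j307492: stalls on four bed rows from the point floor)] -/
@[conjecture] def NonFullTowerConjecture : Prop := TowerTerminates nonFullCentre

/-! ## §3 The two kernel targets of R19.4 (TT-K v2), PROVED -/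

/-- Regularity descends along an isomorphic stalk map. [folklore] -/
theorem mem_regularLocus_of_isIso_stalkMap {S₁ S : Scheme.{0}} (g : S₁ ⟶ S) (s₁ : S₁) [IsIso (g.stalkMap s₁)]
    (h : g.base s₁ ∈ Scheme.regularLocus S) : s₁ ∈ Scheme.regularLocus S₁ := by
  change IsRegularLocalRing (S.presheaf.stalk (g.base s₁)) at h
  change IsRegularLocalRing (S₁.presheaf.stalk s₁)
  exact IsRegularLocalRing.of_ringEquiv (asIso (g.stalkMap s₁)).commRingCatIsoToRingEquiv

/-- A Sing-supported recipe's centre lies inside every CLOSED `F` off which the floor is regular. [folklore] -/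
theorem support_subset_of_regularOff {c : CentreRecipe} (hc : SingSupported c) (p : ℕ) (S : Scheme.{0}) (F : Set S) (hF : IsClosed F)
    (hreg : ∀ s : S, s ∉ F → s ∈ Scheme.regularLocus S) : ((c p S).support : Set S) ⊆ F :=
  (hc p S).trans (closure_minimal (fun s hs => Classical.byContradiction fun h => hs (hreg s h)) hF)

/-- ★ **Lemma A** (generic in the recipe). Sing-supported recipe, Noetherian integral `S` REGULAR off a PROPER closed `F`, and the `c`-tower of height `n` from
`S` ends FULL ⇒ ONE blowing up along some `𝓚 ≠ ⊥` supported in `F` FULL-ifies `S` (every blow-up along `𝓚` is FULL at every point). Induction on `n`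
generalizing the floor, with res-L1-w45a-lead-1's `FullCentreDescent` bricks (p631132): floor zero `exists_fullCentre_of_forall_fullCl` (`𝓚 = ⊤`); at `n + 1`
the centre is `≠ ⊥` (its support lies in `F`, which misses a point), the blowing up `S₁` is Noetherian integral (`isNoetherian_of_isBlowup`, `IsBlowup.isIntegral`),
misses a point over `F` (`exists_not_mem_preimage_of_isBlowup`) and is REGULAR off `g⁻¹F` (`isIso_stalkMap_of_isBlowup_of_not_mem` + regularity along an
isomorphic stalk map); recurse and descend (`exists_fullCentre_of_isBlowup`, Temkin 2.1.4 / Stacks 080B). [folklore assembly; cite: Temkin2008, Lemma 2.1.4]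
[cite: StacksProject, Tag 080B; Tag 02OS] -/
theorem exists_fibreCentre_of_towerFull (c : CentreRecipe) (hc : SingSupported c) (p : ℕ) :
    ∀ (n : ℕ) (S : Scheme.{0}) [IsNoetherian S] [IsIntegral S] (F : Set S), IsClosed F → (∃ s : S, s ∉ F) →
      (∀ s : S, s ∉ F → s ∈ Scheme.regularLocus S) → RecipeTowerFull c p n S →
      ∃ 𝓚 : S.IdealSheafData, 𝓚 ≠ ⊥ ∧ (∀ s ∈ (𝓚.support : Set S), s ∈ F) ∧
        ∀ (S'' : Scheme.{0}) (π : S'' ⟶ S), IsBlowup π 𝓚 → ∀ s : S'', FullCl p (S''.presheaf.stalk s) := by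
  intro n
  induction n with
  | zero =>
    intro S _ _ F _ hne _ hT
    obtain ⟨s, -⟩ := hne
    haveI : Nonempty S := ⟨s⟩
    exact FullCentreDescent.exists_fullCentre_of_forall_fullCl p S F hT
  | succ n ih =>
    intro S _ _ F hF hne hreg hT
    have hcF : ((c p S).support : Set S) ⊆ F := support_subset_of_regularOff hc p S F hF hreg
    -- the centre is non-zero: its support lies in `F`, which misses a point
    have hcne : c p S ≠ ⊥ := by
      intro h
      obtain ⟨s, hs⟩ := hne
      have h1 : (c p S).support = ⊤ := Scheme.IdealSheafData.support_eq_top_iff.mpr h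
      have h2 : s ∈ ((c p S).support : Set S) := by
        rw [h1]
        exact Set.mem_univ s
      exact hs (hcF h2)
    -- blow up the centre: the next floor
    obtain ⟨S₁, g, hg⟩ := exists_isBlowup S (c p S)
    haveI : IsIntegral S₁ := hg.isIntegral hcne
    haveI : IsNoetherian S₁ := FullCentreDescent.isNoetherian_of_isBlowup hg
    -- the next floor is REGULAR off `g⁻¹F` (the blowing up is an isomorphism off its centre `⊆ F`)
    have hreg₁ : ∀ s₁ : S₁, s₁ ∉ g.base ⁻¹' F → s₁ ∈ Scheme.regularLocus S₁ := by
      intro s₁ hs₁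
      haveI := FullCentreDescent.isIso_stalkMap_of_isBlowup_of_not_mem hg s₁ (fun h => hs₁ (hcF h))
      exact mem_regularLocus_of_isIso_stalkMap g s₁ (hreg _ hs₁)
    -- recurse inside `g⁻¹F`, then descend
    obtain h₁ := ih S₁ (g.base ⁻¹' F) (hF.preimage g.continuous) (FullCentreDescent.exists_not_mem_preimage_of_isBlowup hg F hcF hne)
      hreg₁ (hT S₁ g hg)
    exact FullCentreDescent.exists_fullCentre_of_isBlowup p hg F hcF h₁

/-- ★★ **TT[c] ⇒ F-half** for every Sing-supported recipe: Lemma A with `F` := the closed fibre `{s | g s = closed point}` of `g : S′ ⟶ Spec 𝒪_{X,x}` —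
closed (preimage of the closed point); missing a point (the generic point `η` of `Spec 𝒪_{X,x}` is regular, hence `η ∉ supp I ⊆ (Reg)ᶜ`, so the blowing up
`g` is an isomorphism over a neighbourhood of `η` and some `s′ ↦ η`; `η ≠` closed point since otherwise, `X.fromSpecStalk x` being flat, `x ∈ Reg X`); `S′`
REGULAR off it by the F-half's own binder; `S′` Noetherian integral as a blowing up of the Noetherian local scheme along `I ≠ ⊥`.
[folklore assembly; cite: Temkin2008, Lemma 2.1.4 and §2.1; StacksProject, Tag 02OS] -/
theorem localFInjectivizationFibreAdmGe4_of_towerTerminates (c : CentreRecipe) (hc : SingSupported c) (hTT : TowerTerminates c) :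
    LocalFullificationFibreAdmGe4Split.LocalFInjectivizationFibreAdmGe4 := by
  intro d hd p hp k _ _ X f hsep hft hqc hint x hxcl hxs hx S' g I hI hIadm hg hreg hcm
  classical
  haveI : IsLocallyNoetherian X := LocallyOfFiniteType.isLocallyNoetherian f
  haveI : IsIntegral S' := hg.isIntegral hI
  haveI : IsProper g := hg.isProper
  haveI : IsLocallyNoetherian S' := LocallyOfFiniteType.isLocallyNoetherian g
  haveI : CompactSpace S' := QuasiCompact.compactSpace_of_compactSpace g
  haveI : IsNoetherian S' := {}
  obtain ⟨n, hn⟩ := hTT d hd p hp k X f hsep hft hqc hint x hxcl hxs hx S' g I hI hIadm hg hreg hcm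
  -- the closed fibre
  let F : Set S' := {s | g.base s = closedPoint (X.presheaf.stalk x)}
  have hFcl : IsClosed F := by
    have hcp : IsClosed ({closedPoint (X.presheaf.stalk x)} : Set (Spec (X.presheaf.stalk x))) :=
      (PrimeSpectrum.isClosed_singleton_iff_isMaximal _).mpr (IsLocalRing.maximalIdeal.isMaximal _)
    exact hcp.preimage g.continuous
  -- the generic point of `Spec 𝒪_{X,x}` is regular, off `supp I`, and not the closed point
  have hηreg : genericPoint (Spec (X.presheaf.stalk x)) ∈ Scheme.regularLocus (Spec (X.presheaf.stalk x)) :=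
    genericPoint_mem_regularLocus _
  have hηI : genericPoint (Spec (X.presheaf.stalk x)) ∉ (I.support : Set (Spec (X.presheaf.stalk x))) := fun h => hIadm h hηreg
  have hηne : genericPoint (Spec (X.presheaf.stalk x)) ≠ closedPoint (X.presheaf.stalk x) := by
    intro hη
    apply hxs
    haveI : Flat (X.fromSpecStalk x) := flat_fromSpecStalk X x
    have h := (mem_regularLocus_iff_of_flat_of_isPreimmersion (X.fromSpecStalk x) (closedPoint (X.presheaf.stalk x))).mp (hη ▸ hηreg)
    rwa [Scheme.fromSpecStalk_closedPoint] at h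
  -- `F` misses a point: a preimage of the generic point
  have hne : ∃ s : S', s ∉ F := by
    haveI := hg.isIso_compl
    obtain ⟨s, hs⟩ := RegularBlowupModelDim2.exists_preimage_of_isIso_morphismRestrict g
      ⟨(I.support : Set (Spec (X.presheaf.stalk x)))ᶜ, I.support.isClosed.isOpen_compl⟩ _ hηI
    exact ⟨s, fun h => hηne (hs ▸ h)⟩
  exact exists_fibreCentre_of_towerFull c hc p n S' F hFcl hne (fun s hs => hreg s hs) hn

/-! ## §4 Door terms (candidate line v42 «INTRINSIC-CENTRE», by evidence only) -/

/-- crux ⟸ four published theorems ∧ (some Sing-supported recipe's tower terminates) ∧ T″(p,e,1). [OURS · conditional] -/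
theorem fInjectiveMacaulayfication_of_prints_of_tower_of_tStepOne (c : CentreRecipe) (hc : SingSupported c)
    (hG : CossartPiltant2019General.{0}) (h081R : Stacks081R.{0}) (hP : CossartPiltant2019Principalization.{0})
    (hM : CesnaviciusBlowupMacaulayficationOffClosed.{0})
    (hTT : TowerTerminates c)
    (hT1 : ∀ p e : ℕ, p.Prime → 4 ≤ e → TrFullStep.LocalRegularizationFibreFullTr p e 1) :
    Summit.ResolutionOfSingularities.ResolutionOfSingularities.Theses.FrobeniusLadder.FInjectiveMacaulayfication :=
  TrFullStepDoor.fInjectiveMacaulayfication_of_prints_of_LFadmF_of_tStepOne hG h081R hP hM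
    (localFInjectivizationFibreAdmGe4_of_towerTerminates c hc hTT) hT1

/-- **v42's deciding term**: crux ⟸ four published theorems ∧ `TauTowerConjecture` ∧ T″(p,e,1). [OURS · conditional] -/
theorem fInjectiveMacaulayfication_of_prints_of_tauTower_of_tStepOne
    (hG : CossartPiltant2019General.{0}) (h081R : Stacks081R.{0}) (hP : CossartPiltant2019Principalization.{0})
    (hM : CesnaviciusBlowupMacaulayficationOffClosed.{0})
    (hTT : TauTowerConjecture)
    (hT1 : ∀ p e : ℕ, p.Prime → 4 ≤ e → TrFullStep.LocalRegularizationFibreFullTr p e 1) :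
    Summit.ResolutionOfSingularities.ResolutionOfSingularities.Theses.FrobeniusLadder.FInjectiveMacaulayfication :=
  fInjectiveMacaulayfication_of_prints_of_tower_of_tStepOne tauCentre singSupported_tauCentre hG h081R hP hM hTT hT1

end Summit.ResolutionOfSingularities.ResolutionOfSingularities.Theorems.FInjectiveMacaulayfication.IntrinsicTower.Recipes

end
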